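import Literature.Probability.RandomPlanarGeometry.HexSAWPolygonCellsOmegaErase
import HarnessLib

/-!
# Cell calculus for honeycomb polygon surgery, XXXVII: CASE 1 of the decoder — equal ray tops over the same base come from the same stick top

Topic `Literature/Probability/RandomPlanarGeometry` (lane «pcv-sawmu», a-p4 g22; sequel of XXXIII `…OmegaClosedForm`, XXXIV `…PeelStability`, XXXV `…OmegaErase`).

THEOREM-OMEGA-g21 §4, CASE 1, last step («h := the unique cell of T with port_T(h) = w; RETURN T + UR h»): if two admissible sets `S₁`, `S₂` have the
same base `B` and stick tops `c₁`, `c₂` whose ray tops coincide, then `c₁ = c₂` — the hosts coincide by the diagonal separation (P3) of the base ports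
(`PortInv.sep`: rays of distinct hosts live on diagonals ≥ 4 apart) and the levels by the row coordinate. Together with XXXV (`ι (S − c) = ι S − w`) this is
the complete CASE-1 step of the injectivity induction: `ι S₁ = ι S₂`, both in CASE 1, induction hypothesis on `ι (S₁ − c₁) = ι (S₂ − c₂)` ⇒ `S₁ − c₁ = S₂ − c₂`
⇒ same base (XXXIV) ⇒ `c₁ = c₂` (this file) ⇒ `S₁ = S₂`.

Sources: N. Madras, G. Slade, *The Self-Avoiding Walk* (1993), §3.2, proof of Theorem 3.2.3 [MadrasSlade1993]; I. Jensen, J. Phys.: Conf. Ser. 42 (2006) 163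
[Jensen2006HoneycombPolygons].  Label (lane): LANE INFRASTRUCTURE for the lane's step-two injection; nothing new in writing.
-/

open Finset

namespace Literature.Probability.RandomPlanarGeometry.SAW

namespace HexCell

variable {C : Finset Cell → Finset Cell} {P₀ : Finset Cell → Cell → Cell}

/-- `urIter p` is injective in the level. [cite: Jensen2006HoneycombPolygons, §2] -/
theorem urIter_injective (p : Cell) : Function.Injective (urIter p) := by
  intro i j h
  have := congrArg Prod.snd h
  simp [urIter] at this
  omega

/-- ★ **The ray top determines the stick top** (over a fixed base): if `c₁ ∈ S₁ \ B` and `c₂ ∈ S₂ \ B` are peeled hexagons of two brick sets with the same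
base `B = peel S₁ = peel S₂`, no peeled hexagon stands on an exceptional host, the base ports satisfy `PortInv` (in particular (P3) `sep`), and the images
`LL (port c₁) = LL (port c₂)` coincide, then `c₁ = c₂`. [cite: MadrasSlade1993, §3.2 (proof of Theorem 3.2.3)] -/
theorem eq_of_ll_port_eq {X S₁ S₂ : Finset Cell} (hpeel : peel S₁ = peel S₂)
    (hX₁ : ∀ c ∈ S₁ \ peel S₁, LL c ∉ X) (hX₂ : ∀ c ∈ S₂ \ peel S₂, LL c ∉ X)
    (hbase : PortInv X (peel S₁) (C (peel S₁)) (P₀ (peel S₁)))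
    {c₁ c₂ : Cell} (hc₁ : c₁ ∈ S₁ \ peel S₁) (hc₂ : c₂ ∈ S₂ \ peel S₂)
    (heq : LL ((omegaRec C P₀ S₁).2 c₁) = LL ((omegaRec C P₀ S₂).2 c₂)) : c₁ = c₂ := by
  obtain ⟨h₁, i₁, hhost₁, hi₁, he₁, hst₁⟩ := exists_host_stick_of_mem_sdiff_peel hc₁
  obtain ⟨h₂, i₂, hhost₂, hi₂, he₂, hst₂⟩ := exists_host_stick_of_mem_sdiff_peel hc₂
  obtain ⟨j₁, rfl⟩ : ∃ j, i₁ = j + 1 := ⟨i₁ - 1, by omega⟩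
  obtain ⟨j₂, rfl⟩ : ∃ j, i₂ = j + 1 := ⟨i₂ - 1, by omega⟩
  subst he₁; subst he₂
  rw [ll_omegaRec_port_urIter_succ hhost₁.1 hst₁, ll_omegaRec_port_urIter_succ hhost₂.1 hst₂] at heq
  -- the hosts are not exceptional: the first stick cell stands on them
  have hX₁' : h₁ ∉ X := by
    have := hX₁ _ (hst₁ 1 le_rfl (by omega)); rwa [ll_urIter_succ, urIter_zero] at this
  have hX₂' : h₂ ∉ X := by
    have := hX₂ _ (hst₂ 1 le_rfl (by omega)); rwa [ll_urIter_succ, urIter_zero] at this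
  rw [← hpeel] at hhost₂ heq
  -- same host: otherwise the port diagonals are ≥ 4 apart, but the two rays share the hexagon `w`
  have hh : h₁ = h₂ := by
    by_contra hne
    have hsep := hbase.sep hhost₁ hX₁' hhost₂ hX₂' hne
    have hd := congrArg diag heq
    rw [diag_urIter, diag_urIter] at hd
    rw [hd, sub_self, abs_zero] at hsep
    omega
  subst hh
  have hj : j₁ = j₂ := urIter_injective _ heq
  subst hj
  rfl

/-- ★★ **CASE-1 step of the injectivity induction**: two admissible sets with the same shortened set `S₁.erase c₁ = S₂.erase c₂` (stick tops `c₁`, `c₂`)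
and the same ray top `LL (port c₁) = LL (port c₂)` are equal. [cite: MadrasSlade1993, §3.2 (proof of Theorem 3.2.3)] -/
theorem eq_of_erase_stickTop_eq {X S₁ S₂ : Finset Cell} (hS₁ : IsBrickSet S₁) (hS₂ : IsBrickSet S₂)
    (h2₁ : 2 ≤ #(peel S₁)) (h2₂ : 2 ≤ #(peel S₂))
    (hX₁ : ∀ c ∈ S₁ \ peel S₁, LL c ∉ X) (hX₂ : ∀ c ∈ S₂ \ peel S₂, LL c ∉ X)
    (hbase : PortInv X (peel S₁) (C (peel S₁)) (P₀ (peel S₁)))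
    {c₁ c₂ : Cell} (hc₁ : c₁ ∈ S₁ \ peel S₁) (hur₁ : UR c₁ ∉ S₁) (hc₂ : c₂ ∈ S₂ \ peel S₂) (hur₂ : UR c₂ ∉ S₂)
    (hT : S₁.erase c₁ = S₂.erase c₂)
    (heq : LL ((omegaRec C P₀ S₁).2 c₁) = LL ((omegaRec C P₀ S₂).2 c₂)) : S₁ = S₂ := by
  have hpeel : peel S₁ = peel S₂ := by
    rw [← peel_erase_of_stickTop hS₁ h2₁ hc₁ hur₁, hT, peel_erase_of_stickTop hS₂ h2₂ hc₂ hur₂]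
  have hc : c₁ = c₂ := eq_of_ll_port_eq hpeel hX₁ hX₂ hbase hc₁ hc₂ heq
  subst hc
  rw [← insert_erase (mem_sdiff.1 hc₁).1, hT, insert_erase (mem_sdiff.1 hc₂).1]

/-- ★ **(R1) A lex-maximal image hexagon outside the base image is the ray top of a STICK TOP**: if `w ∈ (omegaRec C P₀ S).1 \ C (peel S)` is lex-maximal
in the image, then `w = LL (port c)` for a peeled `c` with `UR c ∉ S` (were `UR c ∈ S`, its image `UR w` would beat `w`).
[cite: MadrasSlade1993, §3.2 (proof of Theorem 3.2.3)] -/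
theorem exists_stickTop_of_lexmax_image {S : Finset Cell} {w : Cell} (hw : w ∈ (omegaRec C P₀ S).1) (hwC : w ∉ C (peel S))
    (hmax : ∀ y ∈ (omegaRec C P₀ S).1, y.2 < w.2 ∨ (y.2 = w.2 ∧ y.1 ≤ w.1)) :
    ∃ c ∈ S \ peel S, UR c ∉ S ∧ w = LL ((omegaRec C P₀ S).2 c) := by
  classical
  rw [omegaRec_image_eq, mem_union] at hw
  rcases hw with hw | hw
  · exact absurd hw hwC
  obtain ⟨m, hm, hmw⟩ := mem_image.1 hw
  refine ⟨m, hm, fun hUR => ?_, hmw.symm⟩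
  -- `UR m` is peeled as well (base hexagons are lex-smaller than `m`)
  have hUR' : UR m ∈ S \ peel S := by
    refine mem_sdiff.2 ⟨hUR, fun hB => ?_⟩
    rcases lt_of_mem_peel_of_mem_sdiff hm hB with h | ⟨h, -⟩
    · simp at h
    · simp at h
  -- its image is `UR w`, lex-larger than `w`
  have hy : LL ((omegaRec C P₀ S).2 (UR m)) ∈ (omegaRec C P₀ S).1 := by
    rw [omegaRec_image_eq]; exact mem_union_right _ (mem_image_of_mem _ hUR')
  rw [omegaRec_port_eq_ur hUR', ll_ur, ll_ur] at hy
  have e : (omegaRec C P₀ S).2 m = UR w := by rw [← hmw, ur_ll]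
  rw [e] at hy
  rcases hmax _ hy with h | ⟨h, -⟩
  · simp at h
  · simp at h

end HexCell

end Literature.Probability.RandomPlanarGeometry.SAW
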